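import Mathlib.Data.Fintype.Perm
import Mathlib.Data.Fintype.BigOperators
import Mathlib.Data.Fintype.Powerset
import Mathlib.Data.Fintype.Pi
import Mathlib.Algebra.BigOperators.Group.Finset.Sigma
import Mathlib.Algebra.BigOperators.Ring.Finset
import Mathlib.Logic.Equiv.Fintype
import Mathlib.Tactic.Ring
import HarnessLib

/-!
# Random relabelling balances a tripartition with probability `≥ (binom(3k,k) binom(2k,k))^r / 27^{kr}`

Topic `Computability/AlgebraicComplexity`. Third instalment (b) of the proof of
`Literature.Computability.AlgebraicComplexity.pratt2024_thm_1_9` (K. Pratt, STOC 2024, Thm. 1.9):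
the counting step of §2,

> "If `{𝓕_i}` did contain a tripartition, `{𝓕_i'}` also will with probability at least
> `p := (binom(3k,k) binom(2k,k))^r / (binom(3n,n) binom(2n,n))` because a tripartition is sent
> to a uniformly random tripartition by `σ`, and `X` contains `(binom(3k,k) binom(2k,k))^r`
> (ordered) tripartitions",

in the form the verified algorithm uses. An ordered tripartition of a finite set `U` is a
labelling `lab : U → Fin 3`; `U` carries a block structure `e : U ≃ Fin r × Fin (3k)`, and a
labelling is *block-balanced* if every block contains exactly `k` points of each label
(`IsBlockBalanced`). For the labelling `lab₀` of a fixed solution (each label used `kr` times,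
`profileLabellings`) and a uniformly random permutation `π` of `U`, the relabelled solution
`lab₀ ∘ π` is block-balanced with probability `#{π | IsBlockBalanced (lab₀ ∘ π)} / |U|!`, and

* **`pow_mul_factorial_le`**:
  `(binom(3k,k) binom(2k,k))^r · |U|! ≤ 3^{|U|} · #{π | IsBlockBalanced (lab₀ ∘ π)}`,

i.e. that probability is at least `(binom(3k,k) binom(2k,k))^r / 27^{kr}` (Pratt bounds the
denominator `binom(3n,n) binom(2n,n)` by `27^n` in the last display of the proof; we use the count of
all labellings, `3^{3kr}`, directly). Ingredients: all fibres of `π ↦ lab₀ ∘ π` over labellings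
with the profile `(kr, kr, kr)` have the same size (`card_fiber_eq`, transitivity of `𝔖_U` via
`Equiv.ofFiberEquiv`), whence `#{π | lab₀ ∘ π ∈ A} · #T = #A · |U|!` for every set `A` of such
labellings (`card_comp_mem_mul`); and there are at least `(binom(3k,k) binom(2k,k))^r` block-balanced
labellings (`pow_le_card_blockBalanced`: an independent balanced labelling of each block, each given
by a `k`-set `S` and a `k`-set `T ⊆ Sᶜ`).

## References

* [Pratt2024SCC] K. Pratt, *A stronger connection between the asymptotic rank conjecture and the
  set cover conjecture*, Proc. 56th STOC (2024), arXiv:2311.02774 — §2, proof of Thm. 1.9.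
-/

namespace Literature.Computability.AlgebraicComplexity

open Finset Equiv

universe u

section General

variable {U : Type u} [Fintype U] [DecidableEq U]

/-! ## Labellings with a given profile -/

/-- The labellings of `U` by `Fin 3` in which every label is used exactly `m` times (ordered
tripartitions of `U` into three `m`-sets). [cite: Pratt2024SCC, Problem 1.3] -/
def profileLabellings (U : Type u) [Fintype U] [DecidableEq U] (m : ℕ) : Finset (U → Fin 3) :=
  {lab | ∀ i : Fin 3, #{u | lab u = i} = m}

/-- Membership in `profileLabellings`. [folklore] -/
@[simp] theorem mem_profileLabellings {m : ℕ} {lab : U → Fin 3} :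
    lab ∈ profileLabellings U m ↔ ∀ i : Fin 3, #{u | lab u = i} = m := by
  simp [profileLabellings]

omit [DecidableEq U] in
/-- Relabelling the points along a permutation does not change fibre sizes. [folklore] -/
theorem card_filter_comp_perm (lab : U → Fin 3) (π : Perm U) (i : Fin 3) :
    #{u | lab (π u) = i} = #{u | lab u = i} := by
  refine Finset.card_bij (fun u _ => π u) (fun u hu => by simpa using hu)
    (fun u _ v _ h => π.injective h) (fun v hv => ⟨π.symm v, by simpa using hv, by simp⟩)

/-- `profileLabellings` is stable under relabelling along permutations. [folklore] -/
theorem comp_mem_profileLabellings {m : ℕ} {lab : U → Fin 3} (h : lab ∈ profileLabellings U m)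
    (π : Perm U) : lab ∘ π ∈ profileLabellings U m := by
  rw [mem_profileLabellings] at h ⊢
  intro i
  rw [← h i]
  exact card_filter_comp_perm lab π i

/-- **Transitivity**: two labellings with the same profile differ by a permutation of the points
(`Equiv.ofFiberEquiv` on fibrewise bijections). [folklore] -/
theorem exists_perm_comp_eq {m : ℕ} {lab lab' : U → Fin 3} (h : lab ∈ profileLabellings U m)
    (h' : lab' ∈ profileLabellings U m) : ∃ τ : Perm U, lab ∘ τ = lab' := by
  classical
  rw [mem_profileLabellings] at h h'
  have hc : ∀ c : Fin 3, Fintype.card {u // lab' u = c} = Fintype.card {u // lab u = c} := by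
    intro c; rw [Fintype.card_subtype, Fintype.card_subtype, h c, h' c]
  refine ⟨Equiv.ofFiberEquiv (f := lab') (g := lab) fun c => Fintype.equivOfCardEq (hc c), ?_⟩
  funext u
  exact Equiv.ofFiberEquiv_map _ u

/-! ## Fibres of `π ↦ lab₀ ∘ π` -/

/-- All fibres of `π ↦ lab₀ ∘ π` over labellings of the profile of `lab₀` have the same size
(right multiplication by a permutation `τ` with `lab ∘ τ = lab'`). [folklore] -/
theorem card_fiber_eq {m : ℕ} (lab₀ : U → Fin 3) {lab lab' : U → Fin 3}
    (h : lab ∈ profileLabellings U m) (h' : lab' ∈ profileLabellings U m) :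
    #{π : Perm U | lab₀ ∘ π = lab} = #{π : Perm U | lab₀ ∘ π = lab'} := by
  obtain ⟨τ, hτ⟩ := exists_perm_comp_eq h h'
  refine Finset.card_bij (fun π _ => π * τ) (fun π hπ => ?_) (fun π _ π' _ e => mul_right_cancel e)
    (fun π' hπ' => ⟨π' * τ⁻¹, ?_, by simp⟩)
  · simp only [Finset.mem_filter, Finset.mem_univ, true_and] at hπ ⊢
    rw [← hτ, ← hπ]; rfl
  · simp only [Finset.mem_filter, Finset.mem_univ, true_and] at hπ' ⊢
    have : lab = lab' ∘ ⇑τ⁻¹ := by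
      rw [← hτ]; funext u; simp [Function.comp, Perm.inv_def]
    rw [this, ← hπ']; rfl

/-- **Uniformity of the relabelled solution**: for every set `A` of labellings with the profile of
`lab₀`, `#{π | lab₀ ∘ π ∈ A} · #(profileLabellings) = #A · |U|!` — under a uniformly random `π`
the labelling `lab₀ ∘ π` is uniformly distributed on the labellings of its profile ("a
tripartition is sent to a uniformly random tripartition by `σ`"). [cite: Pratt2024SCC, §2 (proof of Thm. 1.9)] -/
theorem card_comp_mem_mul {m : ℕ} {lab₀ : U → Fin 3} (h₀ : lab₀ ∈ profileLabellings U m)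
    {A : Finset (U → Fin 3)} (hA : A ⊆ profileLabellings U m) :
    #{π : Perm U | lab₀ ∘ π ∈ A} * #(profileLabellings U m) =
      #A * (Fintype.card U).factorial := by
  classical
  set c₀ := #{π : Perm U | lab₀ ∘ π = lab₀}
  -- every fibre over the profile has size `c₀`
  have hfib : ∀ lab ∈ profileLabellings U m, #{π : Perm U | lab₀ ∘ π = lab} = c₀ :=
    fun lab hlab => card_fiber_eq lab₀ hlab h₀
  -- count `{π | lab₀ ∘ π ∈ B}` fibrewise, for `B ⊆ profile`
  have hcount : ∀ B ⊆ profileLabellings U m, #{π : Perm U | lab₀ ∘ ⇑π ∈ B} = c₀ * #B := by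
    intro B hB
    have hmaps : ∀ π ∈ (Finset.univ.filter fun π : Perm U => lab₀ ∘ ⇑π ∈ B),
        (fun π : Perm U => lab₀ ∘ ⇑π) π ∈ B := fun π hπ => by simpa using hπ
    rw [Finset.card_eq_sum_card_fiberwise hmaps, Finset.sum_const_nat (m := c₀), mul_comm]
    intro lab hlab
    rw [← hfib lab (hB hlab)]
    congr 1; ext π
    simp only [Finset.mem_filter, Finset.mem_univ, true_and, and_iff_right_iff_imp]
    rintro rfl; exact hlab
  -- all permutations: `|U|! = c₀ · #profile`
  have hall : (Fintype.card U).factorial = c₀ * #(profileLabellings U m) := by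
    rw [← hcount _ Finset.Subset.rfl,
      Finset.filter_true_of_mem (fun π _ => comp_mem_profileLabellings h₀ π), Finset.card_univ,
      Fintype.card_perm]
  rw [hcount A hA, hall]; ring

/-- There are at most `3^{|U|}` labellings of any profile. [folklore] -/
theorem card_profileLabellings_le (m : ℕ) : #(profileLabellings U m) ≤ 3 ^ Fintype.card U := by
  calc #(profileLabellings U m) ≤ #(Finset.univ : Finset (U → Fin 3)) := Finset.card_le_univ _
    _ = 3 ^ Fintype.card U := by rw [Finset.card_univ, Fintype.card_fun, Fintype.card_fin]

/-! ## Block-balanced labellings -/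

/-- A labelling of `U ≃ Fin r × Fin (3k)` is **block-balanced** if every block `{b} × Fin (3k)`
contains exactly `k` points of each of the three labels (Pratt's set `X`: "in each `x ∈ X` the
`r` consecutive blocks of length `3k` contain `k` ones each", for the three parts at once).
[cite: Pratt2024SCC, §2 (proof of Thm. 1.9)] -/
def IsBlockBalanced (k r : ℕ) (e : U ≃ Fin r × Fin (3 * k)) (lab : U → Fin 3) : Prop :=
  ∀ b : Fin r, ∀ i : Fin 3, #{t : Fin (3 * k) | lab (e.symm (b, t)) = i} = k

omit [Fintype U] [DecidableEq U] in
/-- Unfolding `IsBlockBalanced`. [folklore] -/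
theorem isBlockBalanced_iff {k r : ℕ} {e : U ≃ Fin r × Fin (3 * k)} {lab : U → Fin 3} :
    IsBlockBalanced k r e lab ↔
      ∀ b : Fin r, ∀ i : Fin 3, #{t : Fin (3 * k) | lab (e.symm (b, t)) = i} = k := Iff.rfl

/-- Block balance is decidable (a finite conjunction of cardinality equations). [folklore] -/
instance (k r : ℕ) (e : U ≃ Fin r × Fin (3 * k)) (lab : U → Fin 3) :
    Decidable (IsBlockBalanced k r e lab) := by
  unfold IsBlockBalanced; infer_instance

omit [DecidableEq U] in
/-- Counting a fibre block by block along `e : U ≃ Fin r × Fin (3k)`. [folklore] -/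
theorem card_filter_eq_sum_blocks {k r : ℕ} (e : U ≃ Fin r × Fin (3 * k)) (lab : U → Fin 3)
    (i : Fin 3) : #{u | lab u = i} = ∑ b : Fin r, #{t : Fin (3 * k) | lab (e.symm (b, t)) = i} := by
  have h1 : #{u | lab u = i} = #{p : Fin r × Fin (3 * k) | lab (e.symm p) = i} := by
    refine Finset.card_bij (fun u _ => e u) (fun u hu => by simpa using hu)
      (fun u _ v _ huv => e.injective huv) (fun p hp => ⟨e.symm p, by simpa using hp, by simp⟩)
  rw [h1, Finset.card_filter, Fintype.sum_prod_type]
  exact Finset.sum_congr rfl fun b _ => (Finset.card_filter _ _).symm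

/-- A block-balanced labelling uses every label exactly `k r` times. [cite: Pratt2024SCC, §2] -/
theorem mem_profileLabellings_of_isBlockBalanced {k r : ℕ} {e : U ≃ Fin r × Fin (3 * k)}
    {lab : U → Fin 3} (h : IsBlockBalanced k r e lab) : lab ∈ profileLabellings U (k * r) := by
  rw [mem_profileLabellings]
  intro i
  rw [card_filter_eq_sum_blocks e lab i, Finset.sum_const_nat fun b _ => h b i, Finset.card_univ,
    Fintype.card_fin, mul_comm]

end General

/-! ## Many block-balanced labellings -/

section Count

/-- The labelling of `Fin (3k)` given by a `k`-set `S` (label `0`), a `k`-set `T ⊆ Sᶜ` (label `1`)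
and the rest (label `2`). [folklore] -/
def labellingOfPair (k : ℕ) (p : (_ : Finset (Fin (3 * k))) × Finset (Fin (3 * k))) :
    Fin (3 * k) → Fin 3 :=
  fun t => if t ∈ p.1 then 0 else if t ∈ p.2 then 1 else 2

/-- The pairs `(S, T)` of disjoint `k`-subsets of `Fin (3k)`. [folklore] -/
def disjointPairs (k : ℕ) : Finset ((_ : Finset (Fin (3 * k))) × Finset (Fin (3 * k))) :=
  (Finset.univ.powersetCard k).sigma fun S => (Sᶜ).powersetCard k

/-- `#disjointPairs k = binom(3k,k) · binom(2k,k)`. [folklore] -/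
theorem card_disjointPairs (k : ℕ) : #(disjointPairs k) = (3 * k).choose k * (2 * k).choose k := by
  rw [disjointPairs, Finset.card_sigma]
  have : ∀ S ∈ (Finset.univ : Finset (Fin (3 * k))).powersetCard k,
      #((Sᶜ).powersetCard k) = (2 * k).choose k := by
    intro S hS
    rw [Finset.card_powersetCard, Finset.card_compl, (Finset.mem_powersetCard.1 hS).2,
      Fintype.card_fin]
    congr 1; omega
  rw [Finset.sum_const_nat this, Finset.card_powersetCard, Finset.card_univ, Fintype.card_fin]

/-- The labelling of a disjoint pair is balanced (`k` points of each label) and determines the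
pair. [folklore] -/
theorem labellingOfPair_fibers {k : ℕ} {p : (_ : Finset (Fin (3 * k))) × Finset (Fin (3 * k))}
    (hp : p ∈ disjointPairs k) :
    ({t | labellingOfPair k p t = 0} : Finset _) = p.1 ∧
      ({t | labellingOfPair k p t = 1} : Finset _) = p.2 ∧
      ({t | labellingOfPair k p t = 2} : Finset _) = (p.1 ∪ p.2)ᶜ := by
  simp only [disjointPairs, Finset.mem_sigma, Finset.mem_powersetCard] at hp
  obtain ⟨⟨-, h1⟩, h2, h3⟩ := hp
  have hdis : ∀ t, t ∈ p.2 → t ∉ p.1 := fun t ht => Finset.mem_compl.1 (h2 ht)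
  refine ⟨?_, ?_, ?_⟩
  · ext t
    simp only [Finset.mem_filter, Finset.mem_univ, true_and, labellingOfPair]
    by_cases ha : t ∈ p.1 <;> by_cases hb : t ∈ p.2 <;> simp [ha, hb]
  · ext t
    simp only [Finset.mem_filter, Finset.mem_univ, true_and, labellingOfPair]
    by_cases ha : t ∈ p.1
    · have hb : t ∉ p.2 := fun hb => hdis t hb ha
      simp [ha, hb]
    · by_cases hb : t ∈ p.2 <;> simp [ha, hb]
  · ext t
    simp only [Finset.mem_filter, Finset.mem_univ, true_and, labellingOfPair, Finset.mem_compl,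
      Finset.mem_union]
    by_cases ha : t ∈ p.1 <;> by_cases hb : t ∈ p.2 <;> simp [ha, hb]

/-- There are at least `binom(3k,k) binom(2k,k)` labellings of `Fin (3k)` with `k` points of each
label (in fact exactly that many). [cite: Pratt2024SCC, §2 (proof of Thm. 1.9)] -/
theorem choose_mul_choose_le_card_profileLabellings (k : ℕ) :
    (3 * k).choose k * (2 * k).choose k ≤ #(profileLabellings (Fin (3 * k)) k) := by
  rw [← card_disjointPairs]
  refine Finset.card_le_card_of_injOn (labellingOfPair k) (fun p hp => ?_) (fun p hp q hq hpq => ?_)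
  · have hp' := Finset.mem_coe.1 hp
    obtain ⟨h0, h1, h2⟩ := labellingOfPair_fibers hp'
    simp only [disjointPairs, Finset.mem_sigma, Finset.mem_powersetCard] at hp'
    obtain ⟨⟨-, hS⟩, hT, hT'⟩ := hp'
    rw [Finset.mem_coe, mem_profileLabellings]
    intro i
    rcases (by omega : i = 0 ∨ i = 1 ∨ i = 2) with rfl | rfl | rfl
    · rw [h0]; exact hS
    · rw [h1]; exact hT'
    · rw [h2, Finset.card_compl, Fintype.card_fin,
        Finset.card_union_of_disjoint (Finset.disjoint_left.2 fun t ht ht' =>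
          (Finset.mem_compl.1 (hT ht')) ht), hS, hT']
      omega
  · obtain ⟨h0, h1, -⟩ := labellingOfPair_fibers (Finset.mem_coe.1 hp)
    obtain ⟨h0', h1', -⟩ := labellingOfPair_fibers (Finset.mem_coe.1 hq)
    rw [hpq] at h0 h1
    exact Sigma.ext (h0.symm.trans h0') (heq_of_eq (h1.symm.trans h1'))

variable {U : Type u} [Fintype U] [DecidableEq U]

/-- Gluing one labelling per block along `e : U ≃ Fin r × Fin (3k)`. [folklore] -/
def glueLabellings {k r : ℕ} (e : U ≃ Fin r × Fin (3 * k)) (μ : Fin r → Fin (3 * k) → Fin 3) :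
    U → Fin 3 :=
  fun u => μ (e u).1 (e u).2

omit [Fintype U] [DecidableEq U] in
/-- The glued labelling restricted to block `b` is `μ b`. [folklore] -/
@[simp] theorem glueLabellings_symm_apply {k r : ℕ} (e : U ≃ Fin r × Fin (3 * k))
    (μ : Fin r → Fin (3 * k) → Fin 3) (b : Fin r) (t : Fin (3 * k)) :
    glueLabellings e μ (e.symm (b, t)) = μ b t := by
  simp [glueLabellings]

/-- **At least `(binom(3k,k) binom(2k,k))^r` block-balanced labellings** ("`X` contains
`(binom(3k,k) binom(2k,k))^r` ordered tripartitions"): glue an independent balanced labelling of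
each block. [cite: Pratt2024SCC, §2 (proof of Thm. 1.9)] -/
theorem pow_le_card_blockBalanced (k r : ℕ) (e : U ≃ Fin r × Fin (3 * k)) :
    ((3 * k).choose k * (2 * k).choose k) ^ r ≤
      #{lab : U → Fin 3 | IsBlockBalanced k r e lab} := by
  classical
  set L := profileLabellings (Fin (3 * k)) k
  calc ((3 * k).choose k * (2 * k).choose k) ^ r ≤ #L ^ r :=
        Nat.pow_le_pow_left (choose_mul_choose_le_card_profileLabellings k) r
    _ = #(Fintype.piFinset fun _ : Fin r => L) := by
        rw [Fintype.card_piFinset, Finset.prod_const, Finset.card_univ, Fintype.card_fin]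
    _ ≤ #{lab : U → Fin 3 | IsBlockBalanced k r e lab} := by
        refine Finset.card_le_card_of_injOn (glueLabellings e) (fun μ hμ => ?_)
          (fun μ _ μ' _ h => ?_)
        · rw [Finset.mem_coe, Fintype.mem_piFinset] at hμ
          rw [Finset.mem_coe, Finset.mem_filter]
          refine ⟨Finset.mem_univ _, fun b i => ?_⟩
          have := (mem_profileLabellings.1 (hμ b)) i
          simpa using this
        · funext b t
          have := congrFun h (e.symm (b, t))
          simpa using this

/-! ## The probability bound -/

/-- **Random relabelling balances a fixed tripartition with probability at least
`(binom(3k,k) binom(2k,k))^r / 3^{|U|}`**: for a labelling `lab₀` of `U ≃ Fin r × Fin (3k)` using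
each label `k r` times,
`(binom(3k,k) binom(2k,k))^r · |U|! ≤ 3^{|U|} · #{π ∈ 𝔖_U | lab₀ ∘ π is block-balanced}`.
This is Pratt's `p = (binom(3k,k) binom(2k,k))^r / (binom(3n,n) binom(2n,n)) ≥ (…)^r / 27^n`
(`n = kr`, `|U| = 3kr`). [cite: Pratt2024SCC, §2 (proof of Thm. 1.9)] -/
theorem pow_mul_factorial_le (k r : ℕ) (e : U ≃ Fin r × Fin (3 * k)) {lab₀ : U → Fin 3}
    (h₀ : lab₀ ∈ profileLabellings U (k * r)) :
    ((3 * k).choose k * (2 * k).choose k) ^ r * (Fintype.card U).factorial ≤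
      3 ^ Fintype.card U * #{π : Perm U | IsBlockBalanced k r e (lab₀ ∘ π)} := by
  classical
  set A : Finset (U → Fin 3) := {lab | IsBlockBalanced k r e lab}
  have hA : A ⊆ profileLabellings U (k * r) := fun lab hlab => by
    simp only [A, Finset.mem_filter, Finset.mem_univ, true_and] at hlab
    exact mem_profileLabellings_of_isBlockBalanced hlab
  have hG : (Finset.univ.filter fun π : Perm U => IsBlockBalanced k r e (lab₀ ∘ ⇑π)) =
      Finset.univ.filter fun π : Perm U => lab₀ ∘ ⇑π ∈ A := by
    ext π; simp [A]
  have key := card_comp_mem_mul h₀ hA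
  rw [← hG] at key
  -- `(CC)^r |U|! ≤ #A |U|! = #G #T ≤ #G 3^|U|`
  calc ((3 * k).choose k * (2 * k).choose k) ^ r * (Fintype.card U).factorial
      ≤ #A * (Fintype.card U).factorial :=
        Nat.mul_le_mul_right _ (pow_le_card_blockBalanced k r e)
    _ = #{π : Perm U | IsBlockBalanced k r e (lab₀ ∘ π)} * #(profileLabellings U (k * r)) := key.symm
    _ ≤ #{π : Perm U | IsBlockBalanced k r e (lab₀ ∘ π)} * 3 ^ Fintype.card U :=
        Nat.mul_le_mul_left _ (card_profileLabellings_le _)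
    _ = _ := mul_comm _ _

end Count

end Literature.Computability.AlgebraicComplexity
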